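import Literature.Barriers.QuantumAdvantage.AaronsonChenOracleProofs
import Literature.Barriers.QuantumAdvantage.AaronsonChenAdvicePSPACE
import Literature.Barriers.QuantumAdvantage.AaronsonChenPhysicsPSPACE
import Literature.Barriers.QuantumAdvantage.TQBFFlatStepCode
import Literature.Barriers.QuantumAdvantage.SampPRelSubsetSampBQPRelHolds
import Literature.Barriers.QuantumAdvantage.AaronsonChenPHLowerBound
import HarnessLib

/-!
# Aaronson–Chen 2017, Cor. 5.2 — discharged

Proof file (theorems only; D-0014 append protocol — a sibling of the barrier entry
`SupremacyTheoremsNonRelativizing.lean`, which cannot import the proof files without an import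
cycle) closing the named fact `aaronsonChen2017_cor52`:

> **Corollary 5.2** ([AaronsonChen2017], p. 21). "There exists an oracle `O' = TQBF ⊕ O` such
> that `SampBPP^{O'} = SampBQP^{O'}` and `PH^{O'}` is infinite."

in the tree's models (`∃ O, SampPRel (Oracle.ofLanguage O) = SampBQPRel O ∧
IsInfinitePHRel (Oracle.ofLanguage O)`, `AaronsonChenOracle.lean`), by applying the tree's proved
assembly of the printed proof to the discharged leaves — every step below is a theorem of the tree:

* **Thm. 5.1 / Cor. 5.2 from Lemma 5.3** (`aaronsonChen2017_cor52_of_lem53`,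
  `AaronsonChenOracleProofs.lean`: `O' = TQBF ⊕ O` for almost every `O ∼ 𝒟_O`; part (i) by
  Borel–Cantelli over the bad pairs `(x, k)`, hard-wiring and the `ε/2` re-run, over the countably
  many `SampBQP` machines, p. 21; the witness from the two probability-one events);
* **Lemma 5.3** (`aaronsonChen2017_lem53_of_physics`, `AaronsonChenAdvicePSPACE.lean`, on top of
  `AaronsonChenSimulation*.lean` — gate-by-gate replacement, eqs. (7)–(10), posterior of `𝒟_n`,
  Chernoff, union bound, Cor. 2.5 — and `AaronsonChenMachine.lean`, the `SampBPP^{TQBF,O}`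
  simulator as a PPT oracle adversary), fed with the `PSPACE`-hardness of `TQBF`
  (`TQBFRed.isHard_PSPACE_TQBF`, Stockmeyer–Meyer, `TQBFFlatStepCode.lean`) and the
  `PSPACE`-membership of the simulator's two physical predicates
  (`AcProto.physics_mem_PSPACE`, `AaronsonChenPhysicsPSPACE.lean`: "all the computations can be
  done in `PSPACE`", p. 23);
* the relativized trivial inclusion `SampBPP^A ⊆ SampBQP^A` (`SampPRel_subset_SampBQPRel_holds`);
* **Thm. 5.1 (ii)**, `PH^{TQBF ⊕ O}` infinite with probability 1 (`aaronsonChen2017_thm51_ph_holds`,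
  `AaronsonChenPHLowerBound.lean`: Rossman–Servedio–Tan's average-case depth hierarchy, Lemma 5.5,
  Furst–Saxe–Sipser relative to `TQBF ⊕ O`, §5.4 p. 24).

No definitions, no named facts (net debt −1: `aaronsonChen2017_cor52` discharged).

## Sources

* [AaronsonChen2017] S. Aaronson, L. Chen, *Complexity-theoretic foundations of quantum supremacy
  experiments*, CCC 2017, LIPIcs 79, 22:1–22:67 (doi:10.4230/LIPIcs.CCC.2017.22;
  arXiv:1612.05903, held, read via `lit read arxiv:1612.05903 --pages 20-24`): Thm. 5.1 and
  Cor. 5.2 (p. 21), Lemma 5.3 (p. 21; proof pp. 21–23), Thm. 5.4, Lemma 5.5 and §5.4 (p. 24).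
* [AroraBarakCC2009] Thm. 4.13 (`TQBF` is `PSPACE`-complete [SM73]), as proved in the tree
  (`TQBFFlatStepCode.lean`).
-/

noncomputable section

namespace Literature.Barriers.QuantumAdvantage

/-- **Aaronson–Chen 2017, Cor. 5.2 — DISCHARGED.** "There exists an oracle `O' = TQBF ⊕ O` such
that `SampBPP^{O'} = SampBQP^{O'}` and `PH^{O'}` is infinite": the named fact
`aaronsonChen2017_cor52` holds, by the tree's assembly `aaronsonChen2017_cor52_of_lem53`
(Thm. 5.1 ⟹ Cor. 5.2) applied to Lemma 5.3 (`aaronsonChen2017_lem53_of_physics` with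
`TQBFRed.isHard_PSPACE_TQBF` and `AcProto.physics_mem_PSPACE`), the relativized inclusion
`SampPRel_subset_SampBQPRel_holds` and the `PH` half `aaronsonChen2017_thm51_ph_holds`.
[cite: AaronsonChen2017, Cor. 5.2 (p. 21); proof via Thm. 5.1, Lemma 5.3 (pp. 21–23) and §5.4 (p. 24)] -/
theorem aaronsonChen2017_cor52_holds : aaronsonChen2017_cor52 :=
  aaronsonChen2017_cor52_of_lem53
    (aaronsonChen2017_lem53_of_physics TQBFRed.isHard_PSPACE_TQBF AcProto.physics_mem_PSPACE)
    SampPRel_subset_SampBQPRel_holds aaronsonChen2017_thm51_ph_holds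

end Literature.Barriers.QuantumAdvantage

end
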